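import Summits.CriticalPhenomena.Ising3DConformalLimit.Theses.BernsteinTemperature

/-!
# CriticalPhenomena / Ising3DConformalLimit — route BernsteinTemperature, assembly

Settles item `stmt-CriticalPhenomena-8364` (rank 1, assembly of route
`route-CriticalPhenomena-BernsteinTemperature`):

`AbsMonotoneTanh → KernelLocalLimit → KernelTransfer → MoebiusLimitOfTwoPointLaw →
IsingEuclidUpgradeR4NonGaussian → Ising3DConformalLimit`.

Pure logic over the summit's structure predicates
(`Literature/Probability/LatticeModels/ScalingLimit3D.lean`): the glue `KernelTransfer` applied to
the two cruxes (AM) `AbsMonotoneTanh` and (KLL) `KernelLocalLimit` gives the isotropic pure power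
law `IsingEuclidUpgradeR2RotInvPowerLaw` of the critical two-point function, which is verbatim the
hypothesis of the imported complement `MoebiusLimitOfTwoPointLaw`; the latter yields `ρ, Δ, S`
with `ρ > 0` on `(0,1]`, `Δ > 0`, `HasPointwiseScalingLimit (criticalCorr 3) ρ S`,
`IsNondegenerateTwoPoint S` and `IsMoebiusCovariant Δ S`; the shared item
`IsingEuclidUpgradeR4NonGaussian` applied to `(ρ, S)` gives `HasNontrivialU4 S`; these are exactly
the six clauses of `CritIsing3DConformalLimit` (= `Ising3DConformalLimit`, an `abbrev`).
No definitions are introduced and no named fact is used; the theorem is unconditional bookkeeping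
(the route's cruxes enter as antecedents of the implication, not as hypotheses of the file).
-/

namespace Summit.CriticalPhenomena.Ising3DConformalLimit.Theorems

open Summit.CriticalPhenomena.Ising3DConformalLimit.Theses.BernsteinTemperature
open Literature.Probability.LatticeModels

/-- Settles `stmt-CriticalPhenomena-8364` (exact signature): the assembly
`AbsMonotoneTanh → KernelLocalLimit → KernelTransfer → MoebiusLimitOfTwoPointLaw →
IsingEuclidUpgradeR4NonGaussian → Ising3DConformalLimit` of route BernsteinTemperature.
Proof: `KernelTransfer (AM) (KLL)` is the isotropic pure power law
`IsingEuclidUpgradeR2RotInvPowerLaw`, the hypothesis of `MoebiusLimitOfTwoPointLaw`, which gives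
`ρ, Δ, S` with `ρ > 0` on `(0,1]`, `Δ > 0`, the pointwise scaling limit, non-degeneracy and
Möbius covariance; `IsingEuclidUpgradeR4NonGaussian ρ S` adds `U₄ ≢ 0`; together these are the
clauses of `CritIsing3DConformalLimit`. [folklore] -/
theorem bernsteinTemperature_assembly_proof :
    Summit.CriticalPhenomena.Ising3DConformalLimit.Theses.BernsteinTemperature.Assembly := by
  unfold Assembly
  intro hAM hKLL hKT hM hE
  -- the glue: (AM) + (KLL) ⇒ isotropic pure power law of the critical two-point function
  have hlaw : IsingEuclidUpgradeR2RotInvPowerLaw := hKT hAM hKLL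
  -- the imported complement: two-point law ⇒ non-degenerate Möbius-covariant scaling limit
  obtain ⟨ρ, Δ, S, hρ, hΔ, hlim, hnd, hmoeb⟩ := hM hlaw
  -- the shared non-triviality item: U₄ ≢ 0
  have hU4 : HasNontrivialU4 S := hE ρ S hρ hlim hnd
  exact ⟨ρ, Δ, S, hρ, hΔ, hlim, hnd, hmoeb, hU4⟩

end Summit.CriticalPhenomena.Ising3DConformalLimit.Theorems
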